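import Literature.AlgebraicGeometry.Frobenioids.ModelFrobenioidComparisonFunctor
import Literature.AlgebraicGeometry.Frobenioids.ModelFrobenioidComparison
import Literature.AlgebraicGeometry.Frobenioids.DivisorialDescriptionsThm51ii
import Literature.AlgebraicGeometry.Frobenioids.BiratUnitsSubfunctor
import HarnessLib

/-!
# Frobenioids I, Theorem 5.2 (iv), proof step: fullness, first half — a morphism with prescribed
degree, base and divisor

Mochizuki, *The geometry of Frobenioids I: the general theory*, Kyushu J. Math. **62** (2008)
293–400, §5, proof of Theorem 5.2 (iv), kurims text p. 103 [cite: MochizukiFrdI2008, Thm. 5.2(iv)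
p.103]:
"… and full [cf. Theorem 5.1, (ii)]".

Given objects `(X, p)`, `(X', p')` of `C′` and a morphism `(d, f, z, υ) : (Base A, cls p) → (Base
A', cls p')`
of the model Frobenioid, relation (d) says `cls(p)^d · z = Φ(f)(cls p') · Div_B(υ)` with
`Div_B(υ) ∈ Φ^birat(Base A)` (the image of `O^×(A^birat)`, Prop. 4.4 (iii),
`BiratUnitsSubfunctor.lean`);
this is the class condition of Theorem 5.1 (ii) (seat L6-t6's `thm51ii_holds`) for the `A`-pairs
underlying `p, p'`, whence a morphism `φ₀ : X → X'` with `deg_Fr φ₀ = d`, `baseOf φ₀ = f`,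
`divOf φ₀ = z`.  (The unit entry is adjusted in the second half.)
-/

namespace Literature.AlgebraicGeometry.Frobenioids

open CategoryTheory Opposite

universe w v v' u u'

namespace PreFrobenioid

namespace FPPath

variable {D : Type u} [Category.{v} D] {Φ : Dᵒᵖ ⥤ CommMonCat.{w}}
  {C : Type u'} [Category.{v'} C] {F : C ⥤ ElemFrobenioid Φ} {P : Set C} {X X' : C}

/-- An `F_P`-path as an `A`-pair (seat L1-t5's `APair`). [cite: MochizukiFrdI2008, Thm. 5.1(i)
p.97] -/
def toAPair (p : FPPath F P X) : APair F p.A := ⟨p.B, X, p.ζA, p.ζX, p.ζA_mem.2, p.ζX_mem.2⟩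

/-- The classes agree: `APair.cls (toAPair p) = cls p`. [cite: MochizukiFrdI2008, Thm. 5.1(i) p.96]
-/
theorem cls_toAPair (p : FPPath F P X) : p.toAPair.cls = cls p := by
  haveI : IsIso (Base F p.ζA) := p.ζA_mem.2.2
  rw [cls_eq]
  change Algebra.GrothendieckGroup.of (pull Φ (inv (Base F p.ζA)) (Div F p.ζX)) /
      Algebra.GrothendieckGroup.of (pull Φ (inv (Base F p.ζA)) (Div F p.ζA)) = _
  rw [map_div, pullGp_of', pullGp_of']

/-- The object `(X, Base ζ_A ∘ Base ζ_X⁻¹)` over `Base A` (seat L1-t5's `IsomOver`).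
[cite: MochizukiFrdI2008, Thm. 5.1 p.96] -/
noncomputable def toIsomOver (p : FPPath F P X) : IsomOver F (baseObj F p.A) := p.toAPair.toIsomOver

/-- `(toIsomOver p).iso.hom = Base(ζ_X)⁻¹ ≫ Base(ζ_A)`. [cite: MochizukiFrdI2008, Thm. 5.1 p.96] -/
theorem toIsomOver_iso_hom (p : FPPath F P X) :
    haveI : IsIso (Base F p.ζX) := p.ζX_mem.2.2
    (toIsomOver p).iso.hom = inv (Base F p.ζX) ≫ Base F p.ζA := rfl

/-- `(toIsomOver p).iso.inv = Base(ζ_A)⁻¹ ≫ Base(ζ_X)`. [cite: MochizukiFrdI2008, Thm. 5.1 p.96] -/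
theorem toIsomOver_iso_inv (p : FPPath F P X) :
    haveI : IsIso (Base F p.ζA) := p.ζA_mem.2.2
    (toIsomOver p).iso.inv = inv (Base F p.ζA) ≫ Base F p.ζX := rfl

/-- **Fullness, first half** (Thm. 5.1 (ii) applied): a model morphism `(d, f, z, υ)` between the
images
of `(X, p)`, `(X', p')` — i.e. data satisfying relation (d) — is matched in degree, base and
divisor by
some `φ₀ : X → X'`. [cite: MochizukiFrdI2008, Thm. 5.2(iv) p.103] -/
theorem exists_hom_of_rel {P : Presection C} (hF : IsFrobenioid F) (hiso : IsOfIsotropicType F)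
    (hP : IsBaseSection F P) (p : FPPath F {A | P.obj A} X)
    (p' : FPPath F {A | P.obj A} X') {B : Dᵒᵖ ⥤ CommMonCat.{w}} {DivB : B ⟶ monoidGp Φ}
    (R : RationalFunctionMonoidStr F hF B DivB) (d : ℕ+) (f : baseObj F p.A ⟶ baseObj F p'.A)
    (z : Φ.obj (op (baseObj F p.A))) (υ : B.obj (op (baseObj F p.A)))
    (hrel : cls p ^ (d : ℕ) * Algebra.GrothendieckGroup.of z =
      pullGp Φ f (cls p') * divB Φ B DivB (op (baseObj F p.A)) υ) :
    ∃ φ : X ⟶ X', degFr F φ = d ∧ baseOf p p' φ = f ∧ divOf p φ = z := by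
  haveI : IsIso (Base F p.ζA) := p.ζA_mem.2.2
  haveI : IsIso (Base F p.ζX) := p.ζX_mem.2.2
  haveI : IsIso (Base F p'.ζA) := p'.ζA_mem.2.2
  haveI : IsIso (Base F p'.ζX) := p'.ζX_mem.2.2
  have hA : IsFrobeniusTrivial F p.A := hP.isFrobeniusTrivial _ p.mem
  have hA' : IsFrobeniusTrivial F p'.A := hP.isFrobeniusTrivial _ p'.mem
  -- the divisor read at `X`
  let z₀ : Φ.obj (op (baseObj F X)) := pull Φ (toIsomOver p).iso.hom z
  have hz : pull Φ (toIsomOver p).iso.inv z₀ = z := by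
    change pull Φ (toIsomOver p).iso.inv (pull Φ (toIsomOver p).iso.hom z) = z
    rw [← pull_comp, Iso.inv_hom_id, pull_id]
  -- `Div_B(υ) ∈ Φ^birat(Base A)`
  have hυ : divB Φ B DivB (op (baseObj F p.A)) υ ∈ biratSubgroup F (baseObj F p.A) := by
    rw [← BiratUnits.range_divHom_eq_biratSubgroup hF p.A hiso]
    exact ⟨R.iso p.A υ, R.div_iso p.A υ⟩
  -- the class condition of Thm. 5.1 (ii)
  have h2 : pullGp Φ f (cls p') =
      (cls p ^ (d : ℕ) * Algebra.GrothendieckGroup.of z) *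
        (divB Φ B DivB (op (baseObj F p.A)) υ)⁻¹ := by
    rw [hrel, mul_inv_cancel_right]
  have hcls : (QuotientGroup.mk p.toAPair.cls : (biratSubfunctor F).Pic (baseObj F p.A)) ^ (d : ℕ) *
      QuotientGroup.mk (Algebra.GrothendieckGroup.of (pull Φ (toIsomOver p).iso.inv z₀)) =
      (biratSubfunctor F).picPull f (QuotientGroup.mk p'.toAPair.cls) := by
    rw [hz, cls_toAPair, cls_toAPair]
    change QuotientGroup.mk (cls p) ^ (d : ℕ) * QuotientGroup.mk (Algebra.GrothendieckGroup.of z) =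
      QuotientGroup.mk (pullGp Φ f (cls p'))
    rw [← QuotientGroup.mk_pow, ← QuotientGroup.mk_mul, QuotientGroup.eq, h2, ← mul_assoc,
      inv_mul_cancel, one_mul]
    exact (biratSubgroup F (baseObj F p.A)).inv_mem hυ
  -- Thm. 5.1 (ii)
  obtain ⟨φ, hφd, hφb, hφz⟩ := (thm51ii_holds F p.A p'.A hF hiso hA hA' (toIsomOver p)
    (toIsomOver p') p.toAPair p'.toAPair rfl rfl d f z₀).mpr hcls
  let φ₁ : X ⟶ X' := φ
  have hφb' : Base F φ₁ =
      (inv (Base F p.ζX) ≫ Base F p.ζA) ≫ f ≫ inv (Base F p'.ζA) ≫ Base F p'.ζX := hφb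
  have hφz' : Div F φ₁ = pull Φ (inv (Base F p.ζX) ≫ Base F p.ζA) z := hφz
  refine ⟨φ₁, hφd, ?_, ?_⟩
  · change inv (Base F p.ζA) ≫ Base F p.ζX ≫ Base F φ₁ ≫ inv (Base F p'.ζX) ≫ Base F p'.ζA = f
    rw [hφb']
    simp only [Category.assoc, IsIso.hom_inv_id_assoc, IsIso.inv_hom_id_assoc, IsIso.inv_hom_id,
      Category.comp_id]
  · change pull Φ (inv (Base F p.ζA)) (pull Φ (Base F p.ζX) (Div F φ₁)) = z
    rw [hφz', ← pull_comp, ← pull_comp]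
    simp only [Category.assoc, IsIso.hom_inv_id_assoc, IsIso.inv_hom_id, pull_id]

end FPPath

end PreFrobenioid

end Literature.AlgebraicGeometry.Frobenioids
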